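import Summits.BirchSwinnertonDyer.BirchSwinnertonDyer.Theorems.Rank2Observatory2DescRowCertSound
import Summits.BirchSwinnertonDyer.BirchSwinnertonDyer.Theorems.Rank2Observatory2DescRowCertLe
import Summits.BirchSwinnertonDyer.BirchSwinnertonDyer.Theorems.Rank2Observatory2DescRowCertReal
import Summits.BirchSwinnertonDyer.BirchSwinnertonDyer.Theorems.ShaPrimaryTransferFiniteShaComponentTransferSelmerCubicDoorTransport
import Summits.BirchSwinnertonDyer.BirchSwinnertonDyer.Theorems.ShaPrimaryTransferFiniteShaComponentTransferSelmerCubicCoverReal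
import Summits.BirchSwinnertonDyer.BirchSwinnertonDyer.Theorems.ShaPrimaryTransferFiniteShaComponentTransferSelmerCubicKillSelList
import HarnessLib

/-!
# BirchSwinnertonDyer — the SEL2CUBIC doors for the KERNEL-2DESC v2.0 row certificates (monogenic cubic `2`-division
# fields with `𝓞_K` a PID; `CurveCert.check`, `checkLe r`, `CurveCertR.checkR r`): certificate ⟹ `t₂(E) = 0`, `Ш(E/ℚ)[2^∞] = 0`, `rank = r`

HONEST FRAMING: route `ShaPrimaryTransfer`, seat `bsd-line-spt-p1` (g31), `--supports` item T =
`FiniteShaComponentTransfer` (stmt-22356), UNCHANGED (conjecture-grade at corank ≥ 2). BSD in rank ≥ 2 is NOT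
proved by any of this. THEOREMS ONLY.

The OLDEST and largest family of the cell-`b2b-bsdr2` kernel `2`-descent census (`Rank2ObservatoryTwoDescRows*`,
`…TwoDescR3Rows*`, `…TwoDescR3RRows*`: ≈ 10,600 curves over monogenic cubic fields with a landed field file proving
`𝓞_K` principal, its unit family, norms, signs, isolating intervals) uses the row certificates `CurveCert` /
`CurveCertR` with INLINE kill lists (`killListCheck`, tier-1 `killCheck` residue trees) and the soundness theorems
`rank_le_two_of_check` (`Rank2Observatory2DescRowCertSound`), `rank_le_of_checkLe r` (`…RowCertLe`),
`rank_le_of_checkR r` (`…RowCertReal`, totally real fields, three sign rows). Their use of the rational point is, as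
everywhere, confined to the norm/sign sieve (`admStd_sound` / `admStd3R_sound`) and the kills (`admKills_sound`) — both
available for `2`-SELMER classes in the PID setting (`admStd_sound_sel` of `…SelmerCubicDoorComplex`,
`admStd3R_sound_sel` of `…SelmerCubicCoverReal`, `natCard_selmerGroup_le_of_coverSet` of `…SelmerCubicCover`, g29;
`admKills_sound_sel`, g30). This file runs the SAME certificates on `Sel⁽²⁾(E/ℚ)`:

* **`sha_door_of_checkCubic`** — `cc.check … ∧ 2 ≤ rank ⟹ door` (adapted from `rank_le_two_of_check`);
* **`sha_door_of_checkCubicLe`** — `cc.checkLe r … ∧ r ≤ rank ⟹ door` (adapted from `rank_le_of_checkLe`);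
* **`sha_door_of_checkCubicR`** — `cc.checkR r … ∧ r ≤ rank ⟹ door` (totally real; adapted from `rank_le_of_checkR`).
The row-shape wrappers (`rank_eq_two_of_check[_complSq]`, `rank_eq_of_checkLe[_complSq]`, `rank_eq_of_checkR[_complSq]`)
are in `…SelmerCubicV2Rows`. [cite: Cassels1991LecturesEllipticCurves, §15] [cite: SilvermanAEC2009, Thm. X.4.2, Rem. X.4.1]
[cite: CremonaAlgorithms1997, §3.6]
-/

-- single-conjunct summit: `Summit.BirchSwinnertonDyer.BirchSwinnertonDyer.…` repeats the name by design
set_option linter.dupNamespace false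

noncomputable section

open scoped Classical NumberField nonZeroDivisors

open Literature.NumberTheory.NumberFields Literature.NumberTheory.EllipticCurves
  Literature.NumberTheory.GaloisRepresentations Polynomial Module NumberField IsDedekindDomain Ideal
open WeierstrassCurve WeierstrassCurve.Affine

namespace Summit.BirchSwinnertonDyer.BirchSwinnertonDyer.Theorems.ShaPrimaryTransferSelmerCubicCover

open Summit.BirchSwinnertonDyer.BirchSwinnertonDyer.Rank2Observatory
open Summit.BirchSwinnertonDyer.BirchSwinnertonDyer.Rank2Observatory.TwoDescCubic
open Summit.BirchSwinnertonDyer.BirchSwinnertonDyer.Rank2Observatory.TwoDescKill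
open Summit.BirchSwinnertonDyer.BirchSwinnertonDyer.Theorems.ShaPrimaryTransferSelmerCubicKill

section Row

variable {K : Type} [Field K] [NumberField K] {a b c : ℤ} {α : K}

/-- **The SEL2CUBIC door for a v2.0 row** (`cc.check`, complex monogenic PID cubic field): `t₂(E) = 0`,
`Ш(E/ℚ)[2^∞] = 0`, `rank E(ℚ) = 2` from the field data, the checked row, the primality list and `2 ≤ rank`. The proof of
`rank_le_two_of_check` verbatim up to the sieve (`admStd_sound_sel`), the kills (`admKills_sound_sel`, `e₀ = t(α)`, `r₁ = 1`)
and the strict closing step on `Sel⁽²⁾(E/ℚ)`. UNCONDITIONAL; BSD is not claimed. [cite: Cassels1991LecturesEllipticCurves, §15] -/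
theorem sha_door_of_checkCubic [IsPrincipalIdealRing (𝓞 K)]
    (hirr : Irreducible (MonicCubic.polyQ a b c)) (hα : aeval α (MonicCubic.poly a b c) = 0)
    (h3 : finrank ℚ K = 3) {m : ℕ} (Wu : Fin m → (𝓞 K)ˣ)
    (hW : ∀ u : (𝓞 K)ˣ, ∃ T : Finset (Fin m), IsSquare (u * ∏ i ∈ T, Wu i))
    (ucoords : Fin m → ℤ × ℤ × ℤ)
    (hWu : ∀ i, ((Wu i : (𝓞 K)ˣ) : 𝓞 K) = lin hα (ucoords i).1 (ucoords i).2.1 (ucoords i).2.2)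
    {Nu : Fin m → ℤ} (hNu : ∀ i, Algebra.norm ℚ (((Wu i : (𝓞 K)ˣ) : 𝓞 K) : K) = Nu i)
    (ρ : K →+* ℝ) {lo hi : ℚ} (h0 : 0 ≤ lo) (hlo : ((lo : ℚ) : ℝ) < ρ α) (hhi : ρ α < ((hi : ℚ) : ℝ))
    {su : Fin m → Bool} (hsu : ∀ i, (su i = true ↔ ρ (((Wu i : (𝓞 K)ˣ) : 𝓞 K) : K) < 0))
    (cc : CurveCert m) (hc : cc.check a b c lo hi ucoords Nu su = true)
    (hprimes : (cc.gens.map GenData.p).Forall Nat.Prime)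
    (hlow : 2 ≤ ((⟨0, cc.A, 0, cc.B, cc.C⟩ : WeierstrassCurve ℚ)).mordellWeilRank) :
    ((⟨0, cc.A, 0, cc.B, cc.C⟩ : WeierstrassCurve ℚ)).shaCorank 2 = 0 ∧
      AddCommGroup.primaryComponent ((⟨0, cc.A, 0, cc.B, cc.C⟩ : WeierstrassCurve ℚ)).sha 2 = ⊥ ∧
        ((⟨0, cc.A, 0, cc.B, cc.C⟩ : WeierstrassCurve ℚ)).mordellWeilRank = 2 := by
  classical
  have hprimes' : ∀ d ∈ cc.gens, d.p.Prime := fun d hd =>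
    (List.forall_iff_forall_mem.mp hprimes) _ (List.mem_map.mpr ⟨d, hd, rfl⟩)
  simp only [CurveCert.check, Bool.and_eq_true, decide_eq_true_eq, List.all_eq_true] at hc
  obtain ⟨⟨⟨⟨⟨⟨⟨⟨⟨⟨⟨hΔ, hirrF⟩, hθ⟩, hder⟩, huinv⟩, hgens⟩, hnodup⟩, hdisc⟩, hQ⟩, hkill⟩, -⟩, hcount⟩ := hc
  haveI hE := isElliptic_of_deltaShort_ne hΔ
  have hirrF' := irreducible_of_noRootMod hirrF
  have haev := aeval_lin_eq_zero_of_coords hα cc.t hθ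
  -- the generators
  set s := cc.gens.length with hs
  set G : Fin s → 𝓞 K := fun j => lin hα (cc.gens.get j).g.1 (cc.gens.get j).g.2.1 (cc.gens.get j).g.2.2
    with hG
  have hGchk : ∀ j : Fin s, (cc.gens.get j).check a b c lo hi = true := fun j => hgens _ (List.get_mem _ _)
  have hGp : ∀ j, Prime (G j) := fun j =>
    GenData.prime_of_check hirr hα h3 (hGchk j) (hprimes' _ (List.get_mem _ _))
  have hGi : Function.Injective G := by
    intro i j hij
    by_contra hne
    have hgne : (cc.gens.get i).g ≠ (cc.gens.get j).g := by
      intro hg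
      apply hne
      have hinj := List.inj_on_of_nodup_map hnodup
      have heq : cc.gens.get i = cc.gens.get j := hinj (List.get_mem _ _) (List.get_mem _ _) hg
      exact (List.Nodup.get_inj_iff (List.Nodup.of_map _ hnodup)).mp heq
    have hne3 : (cc.gens.get i).g.1 ≠ (cc.gens.get j).g.1 ∨ (cc.gens.get i).g.2.1 ≠ (cc.gens.get j).g.2.1 ∨
        (cc.gens.get i).g.2.2 ≠ (cc.gens.get j).g.2.2 := by
      by_contra hcon
      simp only [ne_eq, not_or, not_not] at hcon
      exact hgne (Prod.ext hcon.1 (Prod.ext hcon.2.1 hcon.2.2))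
    exact lin_ne hirr hα h3 hne3 hij
  -- the support of F′(θ)
  have hu : IsUnit (lin hα cc.u.1 cc.u.2.1 cc.u.2.2) := isUnit_lin_of_coords hα cc.u cc.uinv huinv
  have hder' := deriv_eq_of_coords hα cc.t cc.u (cc.gens.map fun d => (d.g, d.e)) hder
  have hD : ∀ q : 𝓞 K, Prime q →
      q ∣ 3 * (lin hα cc.t.1 cc.t.2.1 cc.t.2.2) ^ 2 + 2 * (cc.A : 𝓞 K) * (lin hα cc.t.1 cc.t.2.1 cc.t.2.2) + (cc.B : 𝓞 K) →
      ∃ j, Associated q (G j) := by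
    intro q hq hdvd
    have hdvd' : q ∣ lin hα cc.u.1 cc.u.2.1 cc.u.2.2 *
        ((cc.gens.map fun d => (d.g, d.e)).map fun ge => (lin hα ge.1.1 ge.1.2.1 ge.1.2.2) ^ ge.2).prod := by
      have e : (3 : 𝓞 K) * (lin hα cc.t.1 cc.t.2.1 cc.t.2.2) ^ 2 + 2 * ((cc.A : ℤ) : 𝓞 K) * (lin hα cc.t.1 cc.t.2.1 cc.t.2.2) +
          ((cc.B : ℤ) : 𝓞 K) = _ := hder'
      rw [← e]
      simpa using hdvd
    rcases hq.dvd_or_dvd hdvd' with h1 | h1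
    · exact absurd (isUnit_of_dvd_unit h1 hu) hq.not_unit
    rw [List.map_map] at h1
    obtain ⟨x, hx, hqx⟩ := (Prime.dvd_prod_iff hq).mp h1
    rw [List.mem_map] at hx
    obtain ⟨d, hd, rfl⟩ := hx
    obtain ⟨j, hj⟩ := List.mem_iff_get.mp hd
    refine ⟨j, ?_⟩
    have hqd : q ∣ lin hα d.g.1 d.g.2.1 d.g.2.2 := hq.dvd_of_dvd_pow hqx
    have hGj : G j = lin hα d.g.1 d.g.2.1 d.g.2.2 := by simp only [hG, hj]
    rw [hGj]
    exact hq.associated_of_dvd (hj ▸ hGp j) hqd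
  -- admissibility
  have hQpos : ∀ q ∈ cc.Q, 0 < q := fun q hq' => hQ q hq'
  haveI hEK : (((⟨0, cc.A, 0, cc.B, cc.C⟩ : WeierstrassCurve ℚ)).baseChange K).IsElliptic := ((⟨0, cc.A, 0, cc.B, cc.C⟩ : WeierstrassCurve ℚ)).isElliptic_baseChange K
  have hΔneg : ((⟨0, cc.A, 0, cc.B, cc.C⟩ : WeierstrassCurve ℚ)).Δ < 0 := by
    rw [Δ_shortModel_eq_sixteen_mul_disc]
    exact_mod_cast (show 16 * MonicCubic.disc cc.A cc.B cc.C < 0 by linarith [hdisc])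
  have he₀ : ((1 : ℕ) : K) ^ 2 * algebraMap (𝓞 K) K (lin hα cc.t.1 cc.t.2.1 cc.t.2.2) =
      evZ α (cc.t.1, cc.t.2.1, cc.t.2.2) := by
    rw [Nat.cast_one, one_pow, one_mul]
    exact algebraMap_lin_evZ hα (cc.t.1, cc.t.2.1, cc.t.2.2)
  have hadm : ∀ cS ∈ selmerGroup ((⟨0, cc.A, 0, cc.B, cc.C⟩ : WeierstrassCurve ℚ)) 2, ∀ aK : Kˣ,
      kummerEquiv K 2 (((⟨0, cc.A, 0, cc.B, cc.C⟩ : WeierstrassCurve ℚ)).oneRootDescentH1 K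
        (isTwoTorsionX_of_aeval (A := cc.A) (B := cc.B) (C := cc.C) ((⟨0, cc.A, 0, cc.B, cc.C⟩ : WeierstrassCurve ℚ)) rfl rfl rfl rfl rfl haev) cS) =
        Additive.ofMul (QuotientGroup.mk aK) →
      ∀ (T : Finset (Fin m)) (U : Finset (Fin s)),
        IsSquare ((aK : K) *
          (∏ i ∈ T, algebraMap (𝓞 K) K (Wu i)) * ∏ j ∈ U, algebraMap (𝓞 K) K (G j)) →
        cc.adm a b c ucoords Nu su T U = true := by
    intro cS hcS aK ha T U hsq
    have hstd := admStd_sound_sel (A := cc.A) (B := cc.B) (C := cc.C) ((⟨0, cc.A, 0, cc.B, cc.C⟩ : WeierstrassCurve ℚ)) rfl rfl rfl rfl rfl hirrF' haev h3 ρ hΔneg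
      (w := fun i => algebraMap (𝓞 K) K (Wu i)) (g := fun j => algebraMap (𝓞 K) K (G j))
      (fun i => (RingOfIntegers.coe_ne_zero_iff).mpr (Units.ne_zero _))
      (fun j => (RingOfIntegers.coe_ne_zero_iff).mpr (hGp j).ne_zero)
      (Nu := Nu) (fun i => hNu i)
      (Ng := fun j => (cc.gens.get j).n) (fun j => GenData.norm_of_check hirr hα h3 (hGchk j))
      (su := su) hsu
      (sg := fun j => (cc.gens.get j).sg) (fun j => GenData.sign_iff_of_check hα ρ h0 hlo hhi (hGchk j))
      hcS aK ha T U hsq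
    have hstdQ := admStdQ_of_admStd (Q := cc.Q) hQpos hstd
    exact admKills_sound_sel (A := cc.A) (B := cc.B) (C := cc.C) hirr hα h3
      ((⟨0, cc.A, 0, cc.B, cc.C⟩ : WeierstrassCurve ℚ)) rfl rfl rfl rfl rfl (lin hα cc.t.1 cc.t.2.1 cc.t.2.2) haev
      cc.t.1 1 he₀ (fun i => ((Wu i : (𝓞 K)ˣ) : 𝓞 K)) G hWu (fun j => rfl) hkill hstdQ hcS aK ha hsq
  -- the count, on the Selmer group
  have hsel := natCard_selmerGroup_le_of_coverSet (A := cc.A) (B := cc.B) (C := cc.C)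
    ((⟨0, cc.A, 0, cc.B, cc.C⟩ : WeierstrassCurve ℚ)) rfl rfl rfl rfl rfl hirrF' haev h3 hGi
    (fun j => (hGp j).ne_zero) hD hW (adm := cc.adm a b c ucoords Nu su) hadm
  exact sha_door_of_natCard_selmerGroup_two_lt ((⟨0, cc.A, 0, cc.B, cc.C⟩ : WeierstrassCurve ℚ)) (hsel.trans_lt hcount) hlow

/-- **The SEL2CUBIC door for a v2.0 `r`-row** (`cc.checkLe r`, complex monogenic PID cubic field): `t₂(E) = 0`,
`Ш(E/ℚ)[2^∞] = 0`, `rank E(ℚ) = r`. Adapted from `rank_le_of_checkLe`. UNCONDITIONAL; BSD is not claimed.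
[cite: Cassels1991LecturesEllipticCurves, §15] -/
theorem sha_door_of_checkCubicLe (r : ℕ) [IsPrincipalIdealRing (𝓞 K)]
    (hirr : Irreducible (MonicCubic.polyQ a b c)) (hα : aeval α (MonicCubic.poly a b c) = 0)
    (h3 : finrank ℚ K = 3) {m : ℕ} (Wu : Fin m → (𝓞 K)ˣ)
    (hW : ∀ u : (𝓞 K)ˣ, ∃ T : Finset (Fin m), IsSquare (u * ∏ i ∈ T, Wu i))
    (ucoords : Fin m → ℤ × ℤ × ℤ)
    (hWu : ∀ i, ((Wu i : (𝓞 K)ˣ) : 𝓞 K) = lin hα (ucoords i).1 (ucoords i).2.1 (ucoords i).2.2)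
    {Nu : Fin m → ℤ} (hNu : ∀ i, Algebra.norm ℚ (((Wu i : (𝓞 K)ˣ) : 𝓞 K) : K) = Nu i)
    (ρ : K →+* ℝ) {lo hi : ℚ} (h0 : 0 ≤ lo) (hlo : ((lo : ℚ) : ℝ) < ρ α) (hhi : ρ α < ((hi : ℚ) : ℝ))
    {su : Fin m → Bool} (hsu : ∀ i, (su i = true ↔ ρ (((Wu i : (𝓞 K)ˣ) : 𝓞 K) : K) < 0))
    (cc : CurveCert m) (hc : cc.checkLe r a b c lo hi ucoords Nu su = true)
    (hprimes : (cc.gens.map GenData.p).Forall Nat.Prime)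
    (hlow : r ≤ ((⟨0, cc.A, 0, cc.B, cc.C⟩ : WeierstrassCurve ℚ)).mordellWeilRank) :
    ((⟨0, cc.A, 0, cc.B, cc.C⟩ : WeierstrassCurve ℚ)).shaCorank 2 = 0 ∧
      AddCommGroup.primaryComponent ((⟨0, cc.A, 0, cc.B, cc.C⟩ : WeierstrassCurve ℚ)).sha 2 = ⊥ ∧
        ((⟨0, cc.A, 0, cc.B, cc.C⟩ : WeierstrassCurve ℚ)).mordellWeilRank = r := by
  classical
  have hprimes' : ∀ d ∈ cc.gens, d.p.Prime := fun d hd =>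
    (List.forall_iff_forall_mem.mp hprimes) _ (List.mem_map.mpr ⟨d, hd, rfl⟩)
  simp only [CurveCert.checkLe, Bool.and_eq_true, decide_eq_true_eq, List.all_eq_true] at hc
  obtain ⟨⟨⟨⟨⟨⟨⟨⟨⟨⟨⟨hΔ, hirrF⟩, hθ⟩, hder⟩, huinv⟩, hgens⟩, hnodup⟩, hdisc⟩, hQ⟩, hkill⟩, -⟩, hcount⟩ := hc
  haveI hE := isElliptic_of_deltaShort_ne hΔ
  have hirrF' := irreducible_of_noRootMod hirrF
  have haev := aeval_lin_eq_zero_of_coords hα cc.t hθ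
  -- the generators
  set s := cc.gens.length with hs
  set G : Fin s → 𝓞 K := fun j => lin hα (cc.gens.get j).g.1 (cc.gens.get j).g.2.1 (cc.gens.get j).g.2.2
    with hG
  have hGchk : ∀ j : Fin s, (cc.gens.get j).check a b c lo hi = true := fun j => hgens _ (List.get_mem _ _)
  have hGp : ∀ j, Prime (G j) := fun j =>
    GenData.prime_of_check hirr hα h3 (hGchk j) (hprimes' _ (List.get_mem _ _))
  have hGi : Function.Injective G := by
    intro i j hij
    by_contra hne
    have hgne : (cc.gens.get i).g ≠ (cc.gens.get j).g := by
      intro hg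
      apply hne
      have hinj := List.inj_on_of_nodup_map hnodup
      have heq : cc.gens.get i = cc.gens.get j := hinj (List.get_mem _ _) (List.get_mem _ _) hg
      exact (List.Nodup.get_inj_iff (List.Nodup.of_map _ hnodup)).mp heq
    have hne3 : (cc.gens.get i).g.1 ≠ (cc.gens.get j).g.1 ∨ (cc.gens.get i).g.2.1 ≠ (cc.gens.get j).g.2.1 ∨
        (cc.gens.get i).g.2.2 ≠ (cc.gens.get j).g.2.2 := by
      by_contra hcon
      simp only [ne_eq, not_or, not_not] at hcon
      exact hgne (Prod.ext hcon.1 (Prod.ext hcon.2.1 hcon.2.2))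
    exact lin_ne hirr hα h3 hne3 hij
  -- the support of F′(θ)
  have hu : IsUnit (lin hα cc.u.1 cc.u.2.1 cc.u.2.2) := isUnit_lin_of_coords hα cc.u cc.uinv huinv
  have hder' := deriv_eq_of_coords hα cc.t cc.u (cc.gens.map fun d => (d.g, d.e)) hder
  have hD : ∀ q : 𝓞 K, Prime q →
      q ∣ 3 * (lin hα cc.t.1 cc.t.2.1 cc.t.2.2) ^ 2 + 2 * (cc.A : 𝓞 K) * (lin hα cc.t.1 cc.t.2.1 cc.t.2.2) + (cc.B : 𝓞 K) →
      ∃ j, Associated q (G j) := by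
    intro q hq hdvd
    have hdvd' : q ∣ lin hα cc.u.1 cc.u.2.1 cc.u.2.2 *
        ((cc.gens.map fun d => (d.g, d.e)).map fun ge => (lin hα ge.1.1 ge.1.2.1 ge.1.2.2) ^ ge.2).prod := by
      have e : (3 : 𝓞 K) * (lin hα cc.t.1 cc.t.2.1 cc.t.2.2) ^ 2 + 2 * ((cc.A : ℤ) : 𝓞 K) * (lin hα cc.t.1 cc.t.2.1 cc.t.2.2) +
          ((cc.B : ℤ) : 𝓞 K) = _ := hder'
      rw [← e]
      simpa using hdvd
    rcases hq.dvd_or_dvd hdvd' with h1 | h1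
    · exact absurd (isUnit_of_dvd_unit h1 hu) hq.not_unit
    rw [List.map_map] at h1
    obtain ⟨x, hx, hqx⟩ := (Prime.dvd_prod_iff hq).mp h1
    rw [List.mem_map] at hx
    obtain ⟨d, hd, rfl⟩ := hx
    obtain ⟨j, hj⟩ := List.mem_iff_get.mp hd
    refine ⟨j, ?_⟩
    have hqd : q ∣ lin hα d.g.1 d.g.2.1 d.g.2.2 := hq.dvd_of_dvd_pow hqx
    have hGj : G j = lin hα d.g.1 d.g.2.1 d.g.2.2 := by simp only [hG, hj]
    rw [hGj]
    exact hq.associated_of_dvd (hj ▸ hGp j) hqd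
  -- admissibility
  have hQpos : ∀ q ∈ cc.Q, 0 < q := fun q hq' => hQ q hq'
  haveI hEK : (((⟨0, cc.A, 0, cc.B, cc.C⟩ : WeierstrassCurve ℚ)).baseChange K).IsElliptic := ((⟨0, cc.A, 0, cc.B, cc.C⟩ : WeierstrassCurve ℚ)).isElliptic_baseChange K
  have hΔneg : ((⟨0, cc.A, 0, cc.B, cc.C⟩ : WeierstrassCurve ℚ)).Δ < 0 := by
    rw [Δ_shortModel_eq_sixteen_mul_disc]
    exact_mod_cast (show 16 * MonicCubic.disc cc.A cc.B cc.C < 0 by linarith [hdisc])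
  have he₀ : ((1 : ℕ) : K) ^ 2 * algebraMap (𝓞 K) K (lin hα cc.t.1 cc.t.2.1 cc.t.2.2) =
      evZ α (cc.t.1, cc.t.2.1, cc.t.2.2) := by
    rw [Nat.cast_one, one_pow, one_mul]
    exact algebraMap_lin_evZ hα (cc.t.1, cc.t.2.1, cc.t.2.2)
  have hadm : ∀ cS ∈ selmerGroup ((⟨0, cc.A, 0, cc.B, cc.C⟩ : WeierstrassCurve ℚ)) 2, ∀ aK : Kˣ,
      kummerEquiv K 2 (((⟨0, cc.A, 0, cc.B, cc.C⟩ : WeierstrassCurve ℚ)).oneRootDescentH1 K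
        (isTwoTorsionX_of_aeval (A := cc.A) (B := cc.B) (C := cc.C) ((⟨0, cc.A, 0, cc.B, cc.C⟩ : WeierstrassCurve ℚ)) rfl rfl rfl rfl rfl haev) cS) =
        Additive.ofMul (QuotientGroup.mk aK) →
      ∀ (T : Finset (Fin m)) (U : Finset (Fin s)),
        IsSquare ((aK : K) *
          (∏ i ∈ T, algebraMap (𝓞 K) K (Wu i)) * ∏ j ∈ U, algebraMap (𝓞 K) K (G j)) →
        cc.adm a b c ucoords Nu su T U = true := by
    intro cS hcS aK ha T U hsq
    have hstd := admStd_sound_sel (A := cc.A) (B := cc.B) (C := cc.C) ((⟨0, cc.A, 0, cc.B, cc.C⟩ : WeierstrassCurve ℚ)) rfl rfl rfl rfl rfl hirrF' haev h3 ρ hΔneg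
      (w := fun i => algebraMap (𝓞 K) K (Wu i)) (g := fun j => algebraMap (𝓞 K) K (G j))
      (fun i => (RingOfIntegers.coe_ne_zero_iff).mpr (Units.ne_zero _))
      (fun j => (RingOfIntegers.coe_ne_zero_iff).mpr (hGp j).ne_zero)
      (Nu := Nu) (fun i => hNu i)
      (Ng := fun j => (cc.gens.get j).n) (fun j => GenData.norm_of_check hirr hα h3 (hGchk j))
      (su := su) hsu
      (sg := fun j => (cc.gens.get j).sg) (fun j => GenData.sign_iff_of_check hα ρ h0 hlo hhi (hGchk j))
      hcS aK ha T U hsq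
    have hstdQ := admStdQ_of_admStd (Q := cc.Q) hQpos hstd
    exact admKills_sound_sel (A := cc.A) (B := cc.B) (C := cc.C) hirr hα h3
      ((⟨0, cc.A, 0, cc.B, cc.C⟩ : WeierstrassCurve ℚ)) rfl rfl rfl rfl rfl (lin hα cc.t.1 cc.t.2.1 cc.t.2.2) haev
      cc.t.1 1 he₀ (fun i => ((Wu i : (𝓞 K)ˣ) : 𝓞 K)) G hWu (fun j => rfl) hkill hstdQ hcS aK ha hsq
  -- the count, on the Selmer group
  have hsel := natCard_selmerGroup_le_of_coverSet (A := cc.A) (B := cc.B) (C := cc.C)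
    ((⟨0, cc.A, 0, cc.B, cc.C⟩ : WeierstrassCurve ℚ)) rfl rfl rfl rfl rfl hirrF' haev h3 hGi
    (fun j => (hGp j).ne_zero) hD hW (adm := cc.adm a b c ucoords Nu su) hadm
  exact sha_door_of_natCard_selmerGroup_two_lt ((⟨0, cc.A, 0, cc.B, cc.C⟩ : WeierstrassCurve ℚ)) (hsel.trans_lt hcount) hlow

end Row

end Summit.BirchSwinnertonDyer.BirchSwinnertonDyer.Theorems.ShaPrimaryTransferSelmerCubicCover

end
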